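import Summits.ResolutionOfSingularities.ResolutionOfSingularities.Theorems.PAlterationAssemblyFrobenius
import Summits.ResolutionOfSingularities.ResolutionOfSingularities.Theorems.PAlterationAssemblyPerfectBase
import Literature.AlgebraicGeometry.Limits.ClosedSubschemes
import Literature.AlgebraicGeometry.Limits.FieldExtensionDiagram
import Mathlib.AlgebraicGeometry.Morphisms.ClosedImmersion
import Mathlib.AlgebraicGeometry.Morphisms.Integral
import Mathlib.CategoryTheory.Limits.Shapes.Pullback.Pasting
import Mathlib.FieldTheory.IsPerfectClosure
import HarnessLib

/-!
# `PAlteration.Assembly` (stmt-ResolutionOfSingularities-0553): Frobenius levels of the perfect closure and descent to a full level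

Route `ResolutionOfSingularities/pAlteration`, item `Assembly` (stmt-0553); helper file
(`--supports`). Two ingredients of Theorem B.

## Levels and the relative Frobenius

For a field `k` of characteristic `p` with perfect closure `K`, the *level-`m` subfield*
`k_m = {x ∈ K | x^{p^m} ∈ k} = k^{p^{-m}}` (written `Subfield.comap Frob^m (of k)`):

* `k ⊆ k_m ⊆ k_{m'}` (`m ≤ m'`), every finite subset of `K` lies in some `k_m`;
* `θ_m : k_m ≃ k`, `x ↦ x^{p^m}` (`exists_levelHom`) — the point where FULL levels (not
  finitely generated ones) are needed: `θ_m` is surjective;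
* the **relative Frobenius** `ψ_m : X → Spec k_m ×_k X` of a `k`-scheme `X` locally of finite
  type, `ψ_m = (f ≫ Spec θ_m, F_X^m)`: it is FINITE, universally injective and surjective
  (`exists_relFrobenius`).

## Descent of a closed subscheme of `Spec K ×_k Q` to a full level

Let `Q → Spec k` be separated quasi-compact and locally of finite type and
`m : R ↪ Spec K ×_k Q` a closed immersion. Writing `Spec K ×_k Q = lim_t Spec k(t) ×_k Q` over the
finite subsets `t ⊆ K` (`Literature.AlgebraicGeometry.Limits.FieldExt`), `R` is the base change
of its scheme-theoretic image at some stage `t` (Görtz–Wedhorn I, Prop. 10.75 (1),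
`exists_isPullback_toImage_of_isLocallyNoetherian`), and `k(t)` lies in a full level `k_n`;
base-changing the stage-`t` image to `k_n` gives (`exists_level_model_of_closedImmersion`) a
closed subscheme `R_n ↪ Spec k_n ×_k Q` and `e : R → R_n` over `Q` exhibiting
`R = Spec K ×_{Spec k_n} R_n`.
-/

-- single-problem summit: the doubled namespace component `ResolutionOfSingularities` is forced
set_option linter.dupNamespace false

noncomputable section

open CategoryTheory CategoryTheory.Limits AlgebraicGeometry TopologicalSpace

open Literature.AlgebraicGeometry.Motives

namespace Summit.ResolutionOfSingularities.ResolutionOfSingularities.Theorems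

universe u

/-! ## Universal injectivity cancels on the left -/

/-- If `f ≫ g` is universally injective then so is `f`. [folklore] -/
theorem universallyInjective_of_comp {X Y Z : Scheme.{u}} (f : X ⟶ Y) (g : Y ⟶ Z)
    [h : UniversallyInjective (f ≫ g)] : UniversallyInjective f := by
  have h2 := ((tfae_universallyInjective (f ≫ g)).out 0 1).mp h
  refine ((tfae_universallyInjective f).out 0 1).mpr fun L hL a b hab => ?_
  exact @h2 L hL a b (by simp only [← Category.assoc, hab])

/-! ## The levels -/

section Levels

variable (p : ℕ) [Fact p.Prime] (k : Type u) [Field k] [CharP k p]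

/-- Membership in the level `k_m = Frob^{-m}(k) ⊆ K`. [folklore] -/
theorem mem_level_iff (m : ℕ) (x : PerfectClosure k p) :
    x ∈ Subfield.comap (iterateFrobenius (PerfectClosure k p) p m) (PerfectClosure.of k p).fieldRange ↔
      ∃ y : k, PerfectClosure.of k p y = x ^ p ^ m := by
  simp [Subfield.mem_comap, RingHom.mem_fieldRange, iterateFrobenius_def]

/-- `k ⊆ k_m`. [folklore] -/
theorem of_mem_level (m : ℕ) (y : k) :
    PerfectClosure.of k p y ∈
      Subfield.comap (iterateFrobenius (PerfectClosure k p) p m) (PerfectClosure.of k p).fieldRange :=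
  (mem_level_iff p k m _).mpr ⟨y ^ p ^ m, by rw [map_pow]⟩

/-- The levels increase. [folklore] -/
theorem level_mono {m m' : ℕ} (h : m ≤ m') :
    Subfield.comap (iterateFrobenius (PerfectClosure k p) p m) (PerfectClosure.of k p).fieldRange ≤
      Subfield.comap (iterateFrobenius (PerfectClosure k p) p m') (PerfectClosure.of k p).fieldRange := by
  intro x hx
  obtain ⟨y, hy⟩ := (mem_level_iff p k m x).mp hx
  refine (mem_level_iff p k m' x).mpr ⟨y ^ p ^ (m' - m), ?_⟩
  rw [map_pow, hy, ← pow_mul, ← pow_add, Nat.add_sub_cancel' h]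

/-- Every element of `K` lies in some level. [folklore] -/
theorem exists_mem_level (x : PerfectClosure k p) :
    ∃ m, x ∈ Subfield.comap (iterateFrobenius (PerfectClosure k p) p m) (PerfectClosure.of k p).fieldRange := by
  obtain ⟨n, y, hy⟩ := perfectClosure_pow_mem p x
  exact ⟨n, (mem_level_iff p k n x).mpr ⟨y, hy⟩⟩

/-- Every finite subset of `K` lies in some level. [folklore] -/
theorem exists_finset_subset_level (t : Finset (PerfectClosure k p)) :
    ∃ m, ∀ x ∈ t, x ∈ Subfield.comap (iterateFrobenius (PerfectClosure k p) p m)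
      (PerfectClosure.of k p).fieldRange := by
  classical
  choose n hn using exists_mem_level p k
  refine ⟨t.sup n, fun x hx => level_mono p k (Finset.le_sup hx) (hn x)⟩

/-- **`θ_m : k_m ≃ k`, `x ↦ x^{p^m}`.** There is a bijective ring homomorphism `θ` from the level
`k_m` to `k` with `of (θ x) = x^{p^m}`; on `k ⊆ k_m` it is the `m`-th Frobenius power.
Surjectivity (`y = θ (y^{1/p^m})`) is where full levels are needed. [folklore] -/
theorem exists_levelHom (m : ℕ) :
    ∃ θ : Subfield.comap (iterateFrobenius (PerfectClosure k p) p m) (PerfectClosure.of k p).fieldRange →+* k,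
      Function.Bijective θ ∧ (∀ x, PerfectClosure.of k p (θ x) = (x : PerfectClosure k p) ^ p ^ m) ∧
        ∀ (y : k) (hy), θ ⟨PerfectClosure.of k p y, hy⟩ = y ^ p ^ m := by
  set L := Subfield.comap (iterateFrobenius (PerfectClosure k p) p m) (PerfectClosure.of k p).fieldRange
  have hof : Function.Injective (PerfectClosure.of k p) := (PerfectClosure.of k p).injective
  have key : ∀ x : L, ∃ y : k, PerfectClosure.of k p y = (x : PerfectClosure k p) ^ p ^ m :=
    fun x => (mem_level_iff p k m x.1).mp x.2
  choose s hs using key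
  have h1 : s 1 = 1 := hof (by rw [hs, map_one]; simp)
  have hmul : ∀ x y, s (x * y) = s x * s y := fun x y =>
    hof (by rw [hs, map_mul, hs, hs]; simp [mul_pow])
  have h0 : s 0 = 0 := hof (by
    rw [hs, map_zero]; simp [zero_pow (pow_ne_zero m (Fact.out : p.Prime).ne_zero)])
  have hadd : ∀ x y, s (x + y) = s x + s y := fun x y =>
    hof (by rw [hs, map_add, hs, hs]; simp [add_pow_char_pow _ _ p m])
  let θ : L →+* k :=
    { toFun := s, map_one' := h1, map_mul' := hmul, map_zero' := h0, map_add' := hadd }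
  have hθ : ∀ x, PerfectClosure.of k p (θ x) = (x : PerfectClosure k p) ^ p ^ m := hs
  refine ⟨θ, ⟨θ.injective, fun y => ?_⟩, hθ, fun y hy => hof ?_⟩
  · refine ⟨⟨PerfectClosure.mk k p (m, y), (mem_level_iff p k m _).mpr ⟨y, ?_⟩⟩, hof ?_⟩
    · rw [← PerfectClosure.iterate_frobenius_mk k p m y, iterate_frobenius]
    · rw [hθ]
      change PerfectClosure.mk k p (m, y) ^ p ^ m = _
      rw [← PerfectClosure.iterate_frobenius_mk k p m y, iterate_frobenius]
  · rw [hθ, map_pow]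

end Levels

/-! ## The relative Frobenius to a full level -/

section RelFrobenius

variable (p : ℕ) [Fact p.Prime] {k : Type u} [Field k] [CharP k p] {X : Scheme.{u}}
  (f : X ⟶ Spec (.of k))

/-- **The relative Frobenius `ψ_m : X → Spec k_m ×_k X`.** For a scheme `X` locally of finite
type over a field `k` of characteristic `p` and the level `k_m ⊆ K = k^{p^{-∞}}` (with
`ι_m : k → k_m` the inclusion), there is a morphism `ψ : X → Spec k_m ×_k X` which is FINITE,
universally injective and surjective, whose composite with the projection to `X` is the
`p^m`-power endomorphism `F_X^m`: `ψ = (f ≫ Spec θ_m, F_X^m)`; it is locally of finite type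
because `θ_m : k_m ≃ k`, integral and radicial because `F_X^m` is. [folklore] -/
theorem exists_relFrobenius [LocallyOfFiniteType f] (m : ℕ)
    (hadd : ∀ (U : X.Opens) (a b : Γ(X, U)), (a + b) ^ p ^ m = a ^ p ^ m + b ^ p ^ m) :
    ∃ ψ : X ⟶ pullback (Spec.map (CommRingCat.ofHom ((PerfectClosure.of k p).codRestrict
        (Subfield.comap (iterateFrobenius (PerfectClosure k p) p m) (PerfectClosure.of k p).fieldRange)
        (of_mem_level p k m)))) f,
      IsFinite ψ ∧ UniversallyInjective ψ ∧ Surjective ψ ∧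
        ψ ≫ pullback.snd _ _ = powEndo X (p ^ m) (pow_ne_zero m (Fact.out : p.Prime).ne_zero) hadd := by
  set L := Subfield.comap (iterateFrobenius (PerfectClosure k p) p m) (PerfectClosure.of k p).fieldRange
    with hL
  set ιm : k →+* L := (PerfectClosure.of k p).codRestrict L (of_mem_level p k m) with hιm
  obtain ⟨θ, hθbij, hθ, hθof⟩ := exists_levelHom p k m
  have hpX : (p : Γ(X, ⊤)) = 0 := natCast_appTop_eq_zero p f
  set F := powEndo X (p ^ m) (pow_ne_zero m (Fact.out : p.Prime).ne_zero) hadd with hF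
  -- `θ ∘ ι_m = Frob^m` on `k`
  have hθι : θ.comp ιm = powRingHom k (p ^ m) (pow_ne_zero m (Fact.out : p.Prime).ne_zero)
      (fun a b => add_pow_char_pow a b p m) := by
    ext y
    simp only [RingHom.comp_apply, powRingHom_apply]
    exact hθof y _
  -- the compatibility `(f ≫ Spec θ) ≫ Spec ι_m = F ≫ f`
  have hpk : (p : Γ(Spec (CommRingCat.of k), ⊤)) = 0 := natCast_appTop_eq_zero p (𝟙 _)
  have haddk := add_pow_sections p hpk m
  have w : (f ≫ Spec.map (CommRingCat.ofHom θ)) ≫ Spec.map (CommRingCat.ofHom ιm) = F ≫ f := by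
    rw [Category.assoc, ← Spec.map_comp]
    change f ≫ Spec.map (CommRingCat.ofHom (θ.comp ιm)) = F ≫ f
    rw [hθι, ← powEndo_Spec (p ^ m) _ k _ haddk, hF,
      powEndo_comp (p ^ m) (pow_ne_zero m (Fact.out : p.Prime).ne_zero) hadd f haddk]
  let ψ := pullback.lift (f ≫ Spec.map (CommRingCat.ofHom θ)) F w
  have hψF : ψ ≫ pullback.snd _ _ = F := pullback.lift_snd _ _ _
  -- radicial and surjective
  haveI : UniversallyInjective F := universallyInjective_powEndo X p m hadd hpX
  haveI : UniversallyInjective (ψ ≫ pullback.snd _ _) := by rw [hψF]; infer_instance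
  have hui : UniversallyInjective ψ := universallyInjective_of_comp ψ (pullback.snd _ _)
  haveI : UniversallyInjective (Spec.map (CommRingCat.ofHom ιm)) := by
    refine universallyInjective_specMap_field_of_pow_mem ιm p fun x => ?_
    obtain ⟨y, hy⟩ := (mem_level_iff p k m x.1).mp x.2
    exact ⟨m, y, Subtype.ext hy⟩
  haveI : UniversallyInjective (pullback.snd (Spec.map (CommRingCat.ofHom ιm)) f) :=
    universallyInjective_pullback_snd _ _
  have hsurj : Surjective ψ := ⟨fun z => ⟨(pullback.snd (Spec.map (CommRingCat.ofHom ιm)) f).base z,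
    (pullback.snd (Spec.map (CommRingCat.ofHom ιm)) f).injective (by
      rw [← Scheme.Hom.comp_apply, hψF]; rfl)⟩⟩
  -- finite = integral + locally of finite type
  haveI : IsIntegralHom F := isIntegralHom_powEndo X (p ^ m) _ hadd
  haveI : IsIntegralHom (ψ ≫ pullback.snd _ _) := by rw [hψF]; infer_instance
  have hint : IsIntegralHom ψ := IsIntegralHom.of_comp ψ (pullback.snd _ _)
  haveI : IsIso (Spec.map (CommRingCat.ofHom θ)) := by
    have : IsIso (CommRingCat.ofHom θ) :=
      (ConcreteCategory.isIso_iff_bijective (CommRingCat.ofHom θ)).mpr hθbij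
    infer_instance
  haveI : LocallyOfFiniteType (ψ ≫ pullback.fst _ _) := by
    rw [pullback.lift_fst]; infer_instance
  have hlft : LocallyOfFiniteType ψ := locallyOfFiniteType_of_comp ψ (pullback.fst _ _)
  exact ⟨ψ, (IsFinite.iff_isIntegralHom_and_locallyOfFiniteType ψ).mpr ⟨hint, hlft⟩, hui, hsurj, hψF⟩

end RelFrobenius

/-! ## Descent of a closed subscheme of `Spec K ×_k Q` to a full level -/

section Descent

open Opposite Literature.AlgebraicGeometry.Limits

/-- Elements of `k(t) = k[t] ⊆ K` lie in every level containing `t`. [folklore] -/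
theorem adjoin_subset_level (p : ℕ) [Fact p.Prime] (k : Type) [Field k] [CharP k p]
    (t : Finset (PerfectClosure k p)) (n : ℕ)
    (hn : ∀ x ∈ t, x ∈ Subfield.comap (iterateFrobenius (PerfectClosure k p) p n)
      (PerfectClosure.of k p).fieldRange) :
    letI : Algebra k (PerfectClosure k p) := (PerfectClosure.of k p).toAlgebra
    ∀ x ∈ Algebra.adjoin k (t : Set (PerfectClosure k p)),
      x ∈ Subfield.comap (iterateFrobenius (PerfectClosure k p) p n) (PerfectClosure.of k p).fieldRange := by
  letI : Algebra k (PerfectClosure k p) := (PerfectClosure.of k p).toAlgebra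
  intro x hx
  induction hx using Algebra.adjoin_induction with
  | mem x hx => exact hn x hx
  | algebraMap r => exact of_mem_level p k n r
  | add x y _ _ hx hy => exact add_mem hx hy
  | mul x y _ _ hx hy => exact mul_mem hx hy

-- as in Mathlib's pullback API for schemes
set_option backward.isDefEq.respectTransparency false in
/-- **Descent of a closed subscheme of `Spec K ×_k Q` to a full level** (see the module
docstring): for a closed immersion `m : R ↪ Spec K ×_k Q` there are a level `k_n ⊆ K`, a closed
immersion `ι_n : R_n ↪ Spec k_n ×_k Q` and `e : R → R_n` with `R = Spec K ×_{Spec k_n} R_n`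
(cartesian square `(m ≫ pr₁, e ; Spec K → Spec k_n, ι_n ≫ pr₁)`) and `e ≫ ι_n ≫ pr₂ = m ≫ pr₂`.
[cite: GortzWedhorn2020, Prop. 10.75 (1), p. 333] -/
theorem exists_level_model_of_closedImmersion (p : ℕ) [Fact p.Prime] {k : Type} [Field k]
    [CharP k p] (Q : Over (Spec (CommRingCat.of k))) [QuasiCompact Q.hom] [IsSeparated Q.hom]
    [LocallyOfFiniteType Q.hom] {R : Scheme.{0}}
    (m : R ⟶ pullback (Spec.map (CommRingCat.ofHom (PerfectClosure.of k p))) Q.hom)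
    [IsClosedImmersion m] :
    ∃ (n : ℕ) (Rn : Scheme.{0})
      (ιn : Rn ⟶ pullback (Spec.map (CommRingCat.ofHom ((PerfectClosure.of k p).codRestrict
        (Subfield.comap (iterateFrobenius (PerfectClosure k p) p n) (PerfectClosure.of k p).fieldRange)
        (of_mem_level p k n)))) Q.hom)
      (e : R ⟶ Rn),
      IsClosedImmersion ιn ∧
      IsPullback (m ≫ pullback.fst _ _) e
        (Spec.map (CommRingCat.ofHom (Subfield.comap (iterateFrobenius (PerfectClosure k p) p n)
          (PerfectClosure.of k p).fieldRange).subtype)) (ιn ≫ pullback.fst _ _) ∧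
      e ≫ ιn ≫ pullback.snd _ _ = m ≫ pullback.snd _ _ := by
  -- the perfect closure as a `k`-algebra
  set K := PerfectClosure k p with hK
  letI : Algebra k K := (PerfectClosure.of k p).toAlgebra
  haveI : IsPRadical (algebraMap k K) p := PerfectClosure.isPRadical k p
  haveI : IsPurelyInseparable k K := IsPRadical.isPurelyInseparable k K p
  haveI : Algebra.IsAlgebraic k K := IsPurelyInseparable.isAlgebraic k K
  -- the diagram `t ↦ Spec k(t) ×_k Q` and its limit cone `Spec K ×_k Q`
  let s₁ : Finset K := ∅
  let D := FieldExt.schemeDiagram k K s₁ (.of k) (FieldExt.baseNat k K s₁) Q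
  let c := FieldExt.schemeCone k K s₁ (.of k) (FieldExt.baseNat k K s₁)
    (CommRingCat.ofHom (algebraMap k K)) (FieldExt.baseNat_ι k K s₁) Q
  let hc := FieldExt.isLimitSchemeCone k K s₁ (.of k) (FieldExt.baseNat k K s₁)
    (CommRingCat.ofHom (algebraMap k K)) (FieldExt.baseNat_ι k K s₁) Q
  have hcpt : c.pt = pullback (Spec.map (CommRingCat.ofHom (PerfectClosure.of k p))) Q.hom := rfl
  let m' : R ⟶ c.pt := m
  haveI : IsClosedImmersion m' := ‹IsClosedImmersion m›
  haveI : IsLocallyNoetherian c.pt := by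
    rw [hcpt]
    exact LocallyOfFiniteType.isLocallyNoetherian (pullback.fst _ _)
  -- descent of the closed subscheme to a stage `t`
  obtain ⟨i, hi⟩ := exists_isPullback_toImage_of_isLocallyNoetherian D c hc m'
  let t : Finset K := i.unop.1
  let kt := FieldExt.fld k K t
  -- explicit forms of the leg `Spec K ×_k Q → Spec k(t) ×_k Q`
  let leg : pullback (Spec.map (CommRingCat.ofHom (PerfectClosure.of k p))) Q.hom ⟶
      pullback (Spec.map (CommRingCat.ofHom (algebraMap k kt))) Q.hom := c.π.app i
  let Rt := (m ≫ leg).image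
  let ιt : Rt ⟶ pullback (Spec.map (CommRingCat.ofHom (algebraMap k kt))) Q.hom := (m ≫ leg).imageι
  let τ : R ⟶ Rt := (m ≫ leg).toImage
  have H : IsPullback m τ leg ιt := hi i (𝟙 i)
  have Hπ : IsPullback leg (pullback.fst (Spec.map (CommRingCat.ofHom (PerfectClosure.of k p))) Q.hom)
      (pullback.fst (Spec.map (CommRingCat.ofHom (algebraMap k kt))) Q.hom)
      (Spec.map (CommRingCat.ofHom kt.val.toRingHom)) :=
    FieldExt.isPullback_π k K s₁ (.of k) (FieldExt.baseNat k K s₁)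
      (CommRingCat.ofHom (algebraMap k K)) (FieldExt.baseNat_ι k K s₁) Q i
  have hlegsnd : leg ≫ pullback.snd _ _ =
      pullback.snd (Spec.map (CommRingCat.ofHom (PerfectClosure.of k p))) Q.hom :=
    FieldExt.schemeCone_π_app_snd k K s₁ (.of k) (FieldExt.baseNat k K s₁)
      (CommRingCat.ofHom (algebraMap k K)) (FieldExt.baseNat_ι k K s₁) Q i
  -- `R = Rt ×_{Spec k(t)} Spec K`
  have SqR : IsPullback τ (m ≫ pullback.fst _ _) (ιt ≫ pullback.fst _ _)
      (Spec.map (CommRingCat.ofHom kt.val.toRingHom)) := H.flip.paste_vert Hπ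
  -- a full level `k_n ⊇ k(t)`
  obtain ⟨n, hn⟩ := exists_finset_subset_level p k t
  set L := Subfield.comap (iterateFrobenius K p n) (PerfectClosure.of k p).fieldRange with hL
  have hkt : ∀ x : kt, (x : K) ∈ L := fun x => adjoin_subset_level p k t n hn x.1 x.2
  let incl : kt →+* L := (kt.val : kt →ₐ[k] K).toRingHom.codRestrict L hkt
  let ιn : k →+* L := (PerfectClosure.of k p).codRestrict L (of_mem_level p k n)
  let ιL : L →+* K := L.subtype
  have hιnincl : CommRingCat.ofHom ιn =
      CommRingCat.ofHom (algebraMap k kt) ≫ CommRingCat.ofHom incl := by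
    ext y; rfl
  have hιLincl : CommRingCat.ofHom kt.val.toRingHom =
      CommRingCat.ofHom incl ≫ CommRingCat.ofHom ιL := by
    ext y; rfl
  have hιLιn : CommRingCat.ofHom (PerfectClosure.of k p) =
      CommRingCat.ofHom ιn ≫ CommRingCat.ofHom ιL := by
    ext y; rfl
  -- `Qn = Spec k_n ×_k Q → Qt = Spec k(t) ×_k Q`
  let Qn := pullback (Spec.map (CommRingCat.ofHom ιn)) Q.hom
  let trans : Qn ⟶ pullback (Spec.map (CommRingCat.ofHom (algebraMap k kt))) Q.hom :=
    pullback.map _ _ _ _ (Spec.map (CommRingCat.ofHom incl)) (𝟙 _) (𝟙 _)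
      (by rw [Category.comp_id, ← Spec.map_comp, ← hιnincl]) (by simp)
  have SqQ : IsPullback trans (pullback.fst _ _) (pullback.fst _ _)
      (Spec.map (CommRingCat.ofHom incl)) := by
    refine IsPullback.of_right (h₁₂ := pullback.snd _ _) (v₁₃ := Q.hom)
      (h₂₂ := Spec.map (CommRingCat.ofHom (algebraMap k kt))) ?_ (pullback.lift_fst _ _ _) ?_
    · have e1 : trans ≫ pullback.snd _ _ = pullback.snd _ _ := by simp [trans]
      rw [e1, ← Spec.map_comp, ← hιnincl]
      exact (IsPullback.of_hasPullback _ _).flip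
    · exact (IsPullback.of_hasPullback _ _).flip
  -- `Rn = Rt ×_{Qt} Qn`, a closed subscheme of `Qn`
  let Rn := pullback ιt trans
  let ιRn : Rn ⟶ Qn := pullback.snd ιt trans
  haveI : IsClosedImmersion ιRn := inferInstance
  have SqRn : IsPullback (pullback.fst ιt trans) (ιRn ≫ pullback.fst _ _) (ιt ≫ pullback.fst _ _)
      (Spec.map (CommRingCat.ofHom incl)) :=
    (IsPullback.of_hasPullback ιt trans).paste_vert SqQ
  -- the comparison `e : R → Rn`
  have hcondc : pullback.snd (Spec.map (CommRingCat.ofHom (PerfectClosure.of k p))) Q.hom ≫ Q.hom =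
      pullback.fst _ _ ≫ Spec.map (CommRingCat.ofHom (PerfectClosure.of k p)) :=
    pullback.condition.symm
  let eQ : R ⟶ Qn := pullback.lift (m ≫ pullback.fst _ _ ≫ Spec.map (CommRingCat.ofHom ιL))
    (m ≫ pullback.snd _ _) (by
      rw [Category.assoc, Category.assoc, ← Spec.map_comp, ← hιLιn, Category.assoc, hcondc])
  have w : τ ≫ ιt = eQ ≫ trans := by
    apply pullback.hom_ext
    · rw [Category.assoc, Category.assoc, SqR.w, hιLincl, Spec.map_comp]
      simp [eQ, trans]
    · rw [Category.assoc, Category.assoc]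
      change ((m ≫ leg).toImage ≫ (m ≫ leg).imageι) ≫ pullback.snd _ _ = _
      rw [Scheme.Hom.toImage_imageι, Category.assoc, hlegsnd]
      simp [eQ, trans]
  let e : R ⟶ Rn := pullback.lift τ eQ w
  have heι : e ≫ ιRn = eQ := pullback.lift_snd _ _ _
  -- the cartesian square `R = Spec K ×_{Spec k_n} Rn`
  have SqRm : IsPullback (m ≫ pullback.fst _ _) e (Spec.map (CommRingCat.ofHom ιL))
      (ιRn ≫ pullback.fst _ _) := by
    refine IsPullback.of_bot (v₂₁ := pullback.fst ιt trans) (v₂₂ := Spec.map (CommRingCat.ofHom incl))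
      (h₃₁ := ιt ≫ pullback.fst _ _) ?_ ?_ SqRn.flip
    · have e1 : e ≫ pullback.fst ιt trans = τ := pullback.lift_fst _ _ _
      rw [e1, ← Spec.map_comp, ← hιLincl]
      exact SqR.flip
    · rw [← Category.assoc, heι]
      simp [eQ]
  refine ⟨n, Rn, ιRn, e, inferInstance, SqRm, ?_⟩
  rw [← Category.assoc, heι]
  exact pullback.lift_snd _ _ _

end Descent

end Summit.ResolutionOfSingularities.ResolutionOfSingularities.Theorems

end
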